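import Summits.Ventures.HSemireg.UntwistCocycleTwistLeibnizCocycleHigher
import Summits.Ventures.HSemireg.UntwistCocycleTwistScalarTrace
import HarnessLib

/-!
# Venture HSemireg — route R1.0, untwisted reading: **the Leibniz rule for the HIGHER Atiyah steps `at_j` along the
# cocycle twist**, in the `λ`-intertwining form (gs-g4; row `q ≥ 2` input (A2′) of
# `general-structure/LEIBNIZ-ROW2-PLAN-gs-g4.md` §5; sequel of `UntwistCocycleTwistLeibnizCocycleHigher.lean`)

HONEST FRAMING. Module-level homological algebra on the tree's REAL carriers (`atiyahClassStep E j ∈ Ext¹(E ⊗ Ωʲ, E ⊗ Ωʲ⁺¹)`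
of `SemiregularityHigherSigma`, Čech `classOf`, th-4's cocycle twist, `λ_j = dualHomTwist c E Ωʲ`). Nothing about any
variety; no gerbe; nothing here says HC, HC_CM or HC_AV is proved.

THE THEOREM (`atiyahClassStep_twist`). GIVEN a point-indexed cover `W_x ⊆ U_x` of `X` and local sections `s_x` of
`π_j : Pʲ(E) → E ⊗ Ωʲ` over `W_x` (th-4's bi-frame sections `frameTwistJetSection` provide them when `E` and `Ωʲ` are
finite locally free — `HodgeTheory/AtiyahClassStepCech.lean`; here they are a HYPOTHESIS `s`, `hs`):

  `[λ_j] · at_j(E⟨c⟩) = θ(at_j(E)) · [λ_{j+1}] + [λ_j] · [ν′_j]`  in `Ext¹((E ⊗ Ωʲ)⟨c⟩, E⟨c⟩ ⊗ Ωʲ⁺¹)`,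

`ν′_j` the Čech cocycle `ψ ↦ ω_{xy} ∧ ψ` on `E⟨c⟩ ⊗ Ωʲ` (`twistWedgeFamily`), `ω_{xy} = -g_{xy} d g_{yx}`. At `j = 0` and
with `λ_0 ∘ (ι ⊗ 1) = ι′` this is `atiyahClass_twist` of `UntwistCocycleTwistAtiyah.lean` (there the right ends agree).
Proof: both sides are Čech classes on the cover `W` (classOf of the difference cocycles of the transported sections
`s̃_x`, `ŝ_x`; `classOf_splittingDifference`), `[t] · classOf ω = classOf(t| ≫ ω)` (`classOf_precompFamily`),
`classOf ω · [t] = classOf(ω ≫ t|)` (`classOf_postcompFamily`), and the cochain identity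
`λ_j| ≫ δ′ = δ^θ ≫ λ_{j+1}| + λ_j| ≫ ν′` (`appLE_jetSectionTwistHigher_sub`, `appLE_jetSectionUntwistHigher_sub`).

Which Ext groups: `Ext¹((E ⊗ Ωʲ) ⊗ M, (E ⊗ M) ⊗ Ωʲ⁺¹)`; which class: `at_j`, `[dlog g] ∧`; which twist: `- ⊗ M_B`.

## References

* M. F. Atiyah, Trans. AMS 85 (1957), §4, Prop. 10, Prop. 12. [Atiyah1957]
* R.-O. Buchweitz, H. Flenner, Compositio Math. 137 (2003), Def. 3.4, Thm. 3.10 (`At^k`). [BuchweitzFlenner2003]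
* R. Hartshorne, *Algebraic Geometry* (1977), III.4. [Hartshorne1977]
-/

noncomputable section

open CategoryTheory CategoryTheory.Abelian AlgebraicGeometry Opposite TopologicalSpace Limits

namespace Summit.Ventures.HSemireg

namespace CocycleTwist

open Literature.AlgebraicGeometry.Modules Literature.AlgebraicGeometry.Motives
  Literature.AlgebraicGeometry.HodgeTheory Literature.AlgebraicGeometry.Modules.Cech Literature.Algebra.Homology

universe u

/-! ### Čech classes are natural under PRE-composition -/

section CechPrecomp

variable {Y : Scheme.{u}} {ι : Type u} {U : ι → Y.Opens} {n : ℕ} {A A' M : Y.Modules} (t : A' ⟶ A)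

/-- Pre-composition of a cochain of local homomorphisms with a morphism of sources: `(t ≫ ω)_α = t| ≫ ω_α`. [folklore] -/
def precompFamily (ω : LocalFamily U n A M) : LocalFamily U n A' M := fun α =>
  (SheafOfModules.overFunctor _ (face U α)).map t ≫ ω α

/-- `(t ≫ ω)♯ = t ≫ ω♯`. [folklore] -/
theorem familyHom_precompFamily (ω : LocalFamily U n A M) : familyHom (precompFamily t ω) = t ≫ familyHom ω :=
  hom_ext_to fun V s α => by
    rw [familyHom_app_apply, Scheme.Modules.Hom.comp_app, CategoryTheory.comp_apply, familyHom_app_apply, precompFamily,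
      appLE_comp, appLE_over_map, app_res]

/-- Pre-composition preserves cocycles. [folklore] -/
theorem dFamily_precompFamily_eq_zero (ω : LocalFamily U n A M) (hω : dFamily ω = 0) :
    dFamily (precompFamily t ω) = 0 := by
  apply eq_zero_of_familyHom_eq_zero
  rw [← familyHom_comp_d, familyHom_precompFamily, Category.assoc, familyHom_comp_d, hω, familyHom_zero, Limits.comp_zero]

variable [HasExt.{u + 1} Y.Modules] (hU : iSup U = ⊤)

/-- **`[t ≫ ω] = [t] ∘ [ω]`** (`ExactAugmentation.theta_comp_left`). [cite: Hartshorne1977, III Lemma 4.4] -/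
theorem classOf_precompFamily (ω : LocalFamily U n A M) (hω : dFamily ω = 0) :
    classOf (exactAugmentation U M hU) (precompFamily t ω) (dFamily_precompFamily_eq_zero t ω hω) =
      (Ext.mk₀ t).comp (classOf (exactAugmentation U M hU) ω hω) (zero_add n) := by
  rw [classOf_def, classOf_def, ← ExactAugmentation.theta_comp_left]
  exact ExactAugmentation.theta_congr _ (familyHom_precompFamily t ω) _ _

end CechPrecomp

/-- Values of a negated local homomorphism. [folklore] -/
theorem appLE_neg'' {Y : Scheme.{u}} {M N : Y.Modules} {U V : Y.Opens} (φ : M.over U ⟶ N.over U) (k : V ⟶ U)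
    (s : Γ(M, V)) : appLE (-φ) k s = -appLE φ k s :=
  map_neg (appLEHom k s) φ

/-! ### The setting: a cover `W_x ⊆ U_x` with local sections of `π_j` -/

section Setting

variable {S : Type u} [CommRing S] {X : Over (Spec (CommRingCat.of S))} (c : UnitCocycle X.left)
  (E : X.left.Modules) (j : ℕ) (W : X.left → X.left.Opens) (hWU : ∀ x, W x ≤ c.U x) (hW : iSup W = ⊤)
  (s : ∀ x, (twistHodge E j).over (W x) ⟶ (twistJetModule E j).over (W x))
  (hs : ∀ x, s x ≫ (SheafOfModules.overFunctor _ (W x)).map (twistJetπ E j) = 𝟙 _)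

/-- The twisted level-`j` jet sequence `0 → (E ⊗ Ωʲ⁺¹)⟨c⟩ → Pʲ(E)⟨c⟩ → (E ⊗ Ωʲ)⟨c⟩ → 0`. [folklore] -/
abbrev twistedJetShortComplexHigher : ShortComplex X.left.Modules :=
  (twistJetShortComplex E j).map (twistEquivalence X.left c).functor

/-- It is short exact. [folklore] -/
theorem twistedJetShortComplexHigher_shortExact : (twistedJetShortComplexHigher c E j).ShortExact :=
  (twistJetShortComplex_shortExact E j).map_of_exact (twistEquivalence X.left c).functor

/-- Splittings of the twisted level-`j` sequence over `W_x` from the transported sections `s̃_x`. [folklore] -/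
def twistedJetSplittingsHigher : LocalSplittings W (twistedJetShortComplexHigher c E j) := fun x =>
  localSplittingOfSection (twistedJetShortComplexHigher_shortExact c E j) (W x)
    (jetSectionUntwistHigher c E j x _ (hWU x) (s x))
    (by exact jetSectionUntwistHigher_comp_π c E j x _ (hWU x) (s x) (hs x))

/-- Splittings of the level-`j` sequence of `E⟨c⟩` over `W_x` from the transported sections `ŝ_x`. [folklore] -/
def jetTwistSplittingsHigher : LocalSplittings W (twistJetShortComplex (twist c E) j) := fun x =>
  localSplittingOfSection (twistJetShortComplex_shortExact (twist c E) j) (W x)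
    (jetSectionTwistHigher c E j x _ (hWU x) (s x))
    (jetSectionTwistHigher_comp_π c E j x _ (hWU x) (s x) (hs x))

/-- `δ^θ_j`, typed on `(E ⊗ Ωʲ)⟨c⟩ → (E ⊗ Ωʲ⁺¹)⟨c⟩`. [folklore] -/
def twistedJetDifferenceHigher : LocalFamily W 1 (twist c (twistHodge E j)) (twist c (twistHodge E (j + 1))) :=
  splittingDifference (twistedJetSplittingsHigher c E j W hWU s hs)

/-- `δ′_j`, typed on `E⟨c⟩ ⊗ Ωʲ → E⟨c⟩ ⊗ Ωʲ⁺¹`. [folklore] -/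
def jetTwistDifferenceHigher : LocalFamily W 1 (twistHodge (twist c E) j) (twistHodge (twist c E) (j + 1)) :=
  splittingDifference (jetTwistSplittingsHigher c E j W hWU s hs)

/-- **`ν′_j`**: the cochain `ψ ↦ ω_{xy} ∧ ψ` on `E⟨c⟩ ⊗ Ωʲ` over `W_x ∩ W_y`. [cite: Atiyah1957, Prop. 12] -/
def twistWedgeFamily : LocalFamily W 1 (twistHodge (twist c E) j) (twistHodge (twist c E) (j + 1)) := fun β =>
  postcompOver (dual (twist c E))
    (wedgeHomAt j (dlogForm c (β 0) (β 1) (face W β) ((face_le _ β 0).trans (hWU (β 0))) ((face_le _ β 1).trans (hWU (β 1)))))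

/-- **`ν′_j` is a cocycle** (`dlog` is: `ω_{yz} - ω_{xz} + ω_{xy} = 0`, `dlogForm_cocycle`). [cite: Atiyah1957, Prop. 12] -/
theorem dFamily_twistWedgeFamily : dFamily (twistWedgeFamily c E j W hWU) = 0 := by
  funext β
  refine hom_ext_of_appLE fun V k (ψ : (dual (twist c E)).over V ⟶ (hodgeSheaf X j).over V) => ?_
  have hV0 : V ≤ c.U (β 0) := (k.le.trans (face_le _ β 0)).trans (hWU (β 0))
  have hV1 : V ≤ c.U (β 1) := (k.le.trans (face_le _ β 1)).trans (hWU (β 1))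
  have hV2 : V ≤ c.U (β 2) := (k.le.trans (face_le _ β 2)).trans (hWU (β 2))
  rw [dFamily, appLE_sum, Fin.sum_univ_three, Pi.zero_apply, appLE_zero]
  simp only [Fin.val_zero, pow_zero, one_smul, Fin.val_one, pow_one, neg_one_zsmul, Fin.val_two, neg_one_sq,
    appLE_neg'', appLE_restrictHom, twistWedgeFamily, appLE_postcompOver, restrictHom_wedgeHomAt, map_dlogForm]
  change ψ ≫ wedgeHomAt j (dlogForm c (β 1) (β 2) V hV1 hV2) + -(ψ ≫ wedgeHomAt j (dlogForm c (β 0) (β 2) V hV0 hV2)) +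
      ψ ≫ wedgeHomAt j (dlogForm c (β 0) (β 1) V hV0 hV1) = (0 : (dual (twist c E)).over V ⟶ (hodgeSheaf X (j + 1)).over V)
  rw [← Preadditive.comp_neg, ← wedgeHomAt_neg, ← Preadditive.comp_add, ← Preadditive.comp_add, ← wedgeHomAt_add,
    ← wedgeHomAt_add, ← sub_eq_add_neg, dlogForm_cocycle, wedgeHomAt, evalAt_zero, Limits.comp_zero, Limits.comp_zero]

/-- `δ^θ_j` is a cocycle. [folklore] -/
theorem dFamily_twistedJetDifferenceHigher : dFamily (twistedJetDifferenceHigher c E j W hWU s hs) = 0 :=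
  dFamily_splittingDifference _

/-- `δ′_j` is a cocycle. [folklore] -/
theorem dFamily_jetTwistDifferenceHigher : dFamily (jetTwistDifferenceHigher c E j W hWU s hs) = 0 :=
  dFamily_splittingDifference _

/-- `ι_j⟨c⟩` has injective components. [folklore] -/
theorem twistMap_twistJetι_app_injective (V : X.left.Opens) :
    Function.Injective ((twistMap c (twistJetι E j)).app V) := fun a b h => twist_ext c _ fun w => by
  have hw := congrArg (fun r => comp c (twistJetModule E j) r w) h
  simp only [comp_twistMap_app] at hw
  exact congrArg TwistJetSections.snd hw

/-- `ι′_j` has injective components. [folklore] -/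
theorem twistJetι_app_injective (F : X.left.Modules) (V : X.left.Opens) : Function.Injective ((twistJetι F j).app V) :=
  fun _ _ h => congrArg TwistJetSections.snd h

/-- **`δ^θ_j(φ ⊗ t_x) = D ⊗ t_x`.** [folklore] -/
theorem appLE_twistedJetDifferenceHigher (β : Fin 2 → X.left) {V : X.left.Opens} (k : V ⟶ face W β)
    (φ : (dual E).over V ⟶ (hodgeSheaf X j).over V) :
    appLE (twistedJetDifferenceHigher c E j W hWU s hs β) k
        (trivSection c (twistHodge E j) (β 0) ((k ≫ homOfLE (face_le _ β 0)).le.trans (hWU (β 0))) φ) =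
      trivSection c (twistHodge E (j + 1)) (β 0) ((k ≫ homOfLE (face_le _ β 0)).le.trans (hWU (β 0)))
        (diffFormHigher E j (s (β 0)) (s (β 1)) (k ≫ homOfLE (face_le _ β 0)) (k ≫ homOfLE (face_le _ β 1)) φ) := by
  apply twistMap_twistJetι_app_injective c E j V
  have hT := f_app_appLE_splittingDifference (twistedJetSplittingsHigher c E j W hWU s hs) β k
    (trivSection c (twistHodge E j) (β 0) ((k ≫ homOfLE (face_le _ β 0)).le.trans (hWU (β 0))) φ)
  change (twistMap c (twistJetι E j)).app V (appLE (twistedJetDifferenceHigher c E j W hWU s hs β) k _) =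
    appLE (jetSectionUntwistHigher c E j (β 0) _ (hWU (β 0)) (s (β 0))) _ _ -
      appLE (jetSectionUntwistHigher c E j (β 1) _ (hWU (β 1)) (s (β 1))) _ _ at hT
  rw [hT]
  exact appLE_jetSectionUntwistHigher_sub c E j _ _ _ _ _ _ φ (hs (β 0)) (hs (β 1))

/-- **The level-`j` Leibniz cochain identity, pointwise on `λ_j(φ ⊗ t_x)`.** [cite: Atiyah1957, §4 and Prop. 12] -/
theorem appLE_jetTwistDifferenceHigher (β : Fin 2 → X.left) {V : X.left.Opens} (k : V ⟶ face W β)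
    (φ : (dual E).over V ⟶ (hodgeSheaf X j).over V) :
    appLE (jetTwistDifferenceHigher c E j W hWU s hs β) k
        ((dualHomTwist c E (hodgeSheaf X j)).app V
          (trivSection c (twistHodge E j) (β 0) ((k ≫ homOfLE (face_le _ β 0)).le.trans (hWU (β 0))) φ)) =
      (dualHomTwist c E (hodgeSheaf X (j + 1))).app V
          (appLE (twistedJetDifferenceHigher c E j W hWU s hs β) k
            (trivSection c (twistHodge E j) (β 0) ((k ≫ homOfLE (face_le _ β 0)).le.trans (hWU (β 0))) φ)) +
        wedgeForm j (twist c E)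
          (dlogForm c (β 0) (β 1) V ((k ≫ homOfLE (face_le _ β 0)).le.trans (hWU (β 0)))
            ((k ≫ homOfLE (face_le _ β 1)).le.trans (hWU (β 1))))
          ((dualHomTwist c E (hodgeSheaf X j)).app V
            (trivSection c (twistHodge E j) (β 0) ((k ≫ homOfLE (face_le _ β 0)).le.trans (hWU (β 0))) φ)) := by
  apply twistJetι_app_injective j (twist c E) V
  have hJ := f_app_appLE_splittingDifference (jetTwistSplittingsHigher c E j W hWU s hs) β k
    ((dualHomTwist c E (hodgeSheaf X j)).app V
      (trivSection c (twistHodge E j) (β 0) ((k ≫ homOfLE (face_le _ β 0)).le.trans (hWU (β 0))) φ))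
  change (twistJetι (twist c E) j).app V (appLE (jetTwistDifferenceHigher c E j W hWU s hs β) k _) =
    appLE (jetSectionTwistHigher c E j (β 0) _ (hWU (β 0)) (s (β 0))) _ _ -
      appLE (jetSectionTwistHigher c E j (β 1) _ (hWU (β 1)) (s (β 1))) _ _ at hJ
  rw [hJ, appLE_twistedJetDifferenceHigher]
  exact appLE_jetSectionTwistHigher_sub c E j _ _ _ _ _ _ φ (hs (β 0)) (hs (β 1))

/-- **The level-`j` Leibniz cochain identity**: `λ_j| ≫ δ′_j = δ^θ_j ≫ λ_{j+1}| + λ_j| ≫ ν′_j`. [cite: Atiyah1957, §4 and Prop. 12] -/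
theorem precompFamily_jetTwistDifferenceHigher :
    precompFamily (dualHomTwist c E (hodgeSheaf X j)) (jetTwistDifferenceHigher c E j W hWU s hs) =
      postcompFamily (twistedJetDifferenceHigher c E j W hWU s hs) (dualHomTwist c E (hodgeSheaf X (j + 1))) +
        precompFamily (dualHomTwist c E (hodgeSheaf X j)) (twistWedgeFamily c E j W hWU) := by
  funext β
  refine hom_ext_of_appLE fun V k Φ => ?_
  have hx : V ≤ c.U (β 0) := (k ≫ homOfLE (face_le _ β 0)).le.trans (hWU (β 0))
  rw [← trivSection_coordAt c (twistHodge E j) (β 0) hx Φ, Pi.add_apply, appLE_add, precompFamily, precompFamily,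
    postcompFamily]
  simp only [appLE_comp, appLE_over_map]
  rw [appLE_jetTwistDifferenceHigher, twistWedgeFamily, appLE_postcompOver, restrictHom_wedgeHomAt, map_dlogForm]
  rfl

variable [HasExt.{u + 1} X.left.Modules]

/-- **The main term `θ(at_j(E)) · [λ_{j+1}]`**, typed on `Ext¹((E ⊗ Ωʲ)⟨c⟩, E⟨c⟩ ⊗ Ωʲ⁺¹)`. [folklore] -/
def atiyahClassStepTwistMain : Ext.{u + 1} (twist c (twistHodge E j)) (twistHodge (twist c E) (j + 1)) 1 :=
  ((twistEquivalence X.left c).functor.mapExtAddHom _ _ 1 (atiyahClassStep E j)).comp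
    (Ext.mk₀ (dualHomTwistObj c E (hodgeSheaf X (j + 1)))) (add_zero 1)

/-- Unfolding the main term. [folklore] -/
theorem atiyahClassStepTwistMain_def : atiyahClassStepTwistMain c E j =
    ((twistEquivalence X.left c).functor.mapExtAddHom _ _ 1 (atiyahClassStep E j)).comp
      (Ext.mk₀ (dualHomTwistObj c E (hodgeSheaf X (j + 1)))) (add_zero 1) := rfl

include s hs in
/-- **The Leibniz rule for the higher Atiyah step `at_j` along `- ⊗ M`, `λ`-intertwining form**:
`[λ_j] · at_j(E⟨c⟩) = θ(at_j(E)) · [λ_{j+1}] + [λ_j] · [ν′_j]` in `Ext¹((E ⊗ Ωʲ)⟨c⟩, E⟨c⟩ ⊗ Ωʲ⁺¹)`, given local sections of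
`π_j` over a cover `W_x ⊆ U_x` (the classes do not depend on the sections). [cite: Atiyah1957, Prop. 10 and Prop. 12; BuchweitzFlenner2003, Thm. 3.10] -/
theorem atiyahClassStep_twist :
    (Ext.mk₀ (dualHomTwist c E (hodgeSheaf X j))).comp (atiyahClassStep (twist c E) j) (zero_add 1) =
      atiyahClassStepTwistMain c E j +
        (Ext.mk₀ (dualHomTwist c E (hodgeSheaf X j))).comp
          (classOf (exactAugmentation W _ hW) (twistWedgeFamily c E j W hWU) (dFamily_twistWedgeFamily c E j W hWU))
          (zero_add 1) := by
  have hJ : classOf (exactAugmentation W (twistHodge (twist c E) (j + 1)) hW) (jetTwistDifferenceHigher c E j W hWU s hs)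
      (dFamily_jetTwistDifferenceHigher c E j W hWU s hs) = atiyahClassStep (twist c E) j :=
    classOf_splittingDifference_exactAugmentation (jetTwistSplittingsHigher c E j W hWU s hs)
      (twistJetShortComplex_shortExact (twist c E) j) hW
  have hT : classOf (exactAugmentation W (twist c (twistHodge E (j + 1))) hW) (twistedJetDifferenceHigher c E j W hWU s hs)
      (dFamily_twistedJetDifferenceHigher c E j W hWU s hs) =
      (twistEquivalence X.left c).functor.mapExtAddHom _ _ 1 (atiyahClassStep E j) :=
    (classOf_splittingDifference_exactAugmentation (twistedJetSplittingsHigher c E j W hWU s hs)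
      (twistedJetShortComplexHigher_shortExact c E j) hW).trans
      (Ext.mapExactFunctor_extClass (twistEquivalence X.left c).functor (twistJetShortComplex_shortExact E j)).symm
  have e1 : (Ext.mk₀ (dualHomTwist c E (hodgeSheaf X j))).comp (atiyahClassStep (twist c E) j) (zero_add 1) =
      classOf (exactAugmentation W _ hW) (precompFamily (dualHomTwist c E (hodgeSheaf X j))
        (jetTwistDifferenceHigher c E j W hWU s hs))
        (dFamily_precompFamily_eq_zero _ _ (dFamily_jetTwistDifferenceHigher c E j W hWU s hs)) := by
    rw [← hJ]
    exact (classOf_precompFamily _ hW _ _).symm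
  have e3 : classOf (exactAugmentation W _ hW) (postcompFamily (twistedJetDifferenceHigher c E j W hWU s hs)
        (dualHomTwist c E (hodgeSheaf X (j + 1))))
        (dFamily_postcompFamily_eq_zero _ _ (dFamily_twistedJetDifferenceHigher c E j W hWU s hs)) =
      atiyahClassStepTwistMain c E j := by
    rw [classOf_postcompFamily (dualHomTwist c E (hodgeSheaf X (j + 1))) hW _
      (dFamily_twistedJetDifferenceHigher c E j W hWU s hs), hT]
    rfl
  rw [e1, classOf_congr _ (precompFamily_jetTwistDifferenceHigher c E j W hWU s hs) _
      (by rw [← precompFamily_jetTwistDifferenceHigher c E j W hWU s hs]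
          exact dFamily_precompFamily_eq_zero _ _ (dFamily_jetTwistDifferenceHigher c E j W hWU s hs)),
    classOf_add _ _ _ (dFamily_postcompFamily_eq_zero _ _ (dFamily_twistedJetDifferenceHigher c E j W hWU s hs))
      (dFamily_precompFamily_eq_zero _ _ (dFamily_twistWedgeFamily c E j W hWU)), e3,
    classOf_precompFamily (dualHomTwist c E (hodgeSheaf X j)) hW _ (dFamily_twistWedgeFamily c E j W hWU)]

end Setting

end CocycleTwist

end Summit.Ventures.HSemireg

end
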